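import Summits.Ventures.PercRepro.MSTightLocalDichotomyGenuine

/-!
# A covering subfamily of a twin-free family has no twins on its difference support

Dossier proofs/MINE1-theoremS.md, Addendum 52 §3. A subfamily `K` of a twin-free family `P`
*covers* when every other member `p` of `P` is eligible on one side: `p \\ K ⊆ D(K)` or
`K \\ p ⊆ D(K)` (the hypothesis of the local dichotomy, Addendum 50 suppl. 3 / Addendum 51,
without the excess hypothesis and without the partition). Two elements `e ≠ e'` that lie in some
member of `K` and outside some member of `K` are then never `K`-twins: `P` separates them by a
member `p ∉ K`; if `p \\ K ⊆ D(K)`, a member `k ∈ K` avoiding both gives a difference `p ∖ k`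
of `K` containing one twin and not the other; if `K \\ p ⊆ D(K)`, a member containing both gives
the difference `k ∖ p` with the same defect (`eq_of_twin_of_cover`). Consequently the partner
family of the open shape is twin-free on its difference support, and so is every tight one-point
extension of it — the first structural input of the TightExt half (i) (Addendum 52 §3–§4).
-/

namespace PercRepro.MSTight

open Finset
open scoped FinsetFamily

variable {α : Type*} [DecidableEq α]

/-- A difference of `K` contains both or neither of two `K`-twins. -/
theorem mem_iff_mem_of_twin_of_mem_diffs {K : Finset (Finset α)} {e e' : α} (h : Twin K e e')
    {w : Finset α} (hw : w ∈ K \\ K) : e ∈ w ↔ e' ∈ w := by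
  obtain ⟨k₁, hk₁, k₂, hk₂, rfl⟩ := mem_diffs.1 hw
  simp only [mem_sdiff]
  rw [h k₁ hk₁, h k₂ hk₂]

/-- The one-sided step: a member `p ∉ K` with `e ∈ p`, `e' ∉ p` is impossible for `K`-twins
`e, e'` on the difference support of `K` when `p` is eligible on either side. -/
theorem not_mem_of_twin_of_cover {K : Finset (Finset α)} {e e' : α} (h : Twin K e e')
    (he : ∃ k ∈ K, e ∈ k) (he' : ∃ k ∈ K, e ∉ k) {p : Finset α}
    (hp : (∀ k ∈ K, p \ k ∈ K \\ K) ∨ (∀ k ∈ K, k \ p ∈ K \\ K)) (hep : e ∈ p) :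
    e' ∈ p := by
  rcases hp with hp | hp
  · obtain ⟨k, hk, hek⟩ := he'
    have hw := hp k hk
    have h1 : e ∈ p \ k := mem_sdiff.2 ⟨hep, hek⟩
    have h2 := (mem_iff_mem_of_twin_of_mem_diffs h hw).1 h1
    exact (mem_sdiff.1 h2).1
  · obtain ⟨k, hk, hek⟩ := he
    have hw := hp k hk
    by_contra hne
    have h1 : e' ∈ k \ p := mem_sdiff.2 ⟨(h k hk).1 hek, hne⟩
    have h2 := (mem_iff_mem_of_twin_of_mem_diffs h hw).2 h1
    exact (mem_sdiff.1 h2).2 hep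

/-- **A covering subfamily of a twin-free family has no twins on its difference support.** -/
theorem eq_of_twin_of_cover {P K : Finset (Finset α)} (htf : ∀ a b, Twin P a b → a = b)
    (hcov : ∀ p ∈ P, p ∉ K → (∀ k ∈ K, p \ k ∈ K \\ K) ∨ (∀ k ∈ K, k \ p ∈ K \\ K))
    {e e' : α} (h : Twin K e e') (he : ∃ k ∈ K, e ∈ k) (he' : ∃ k ∈ K, e ∉ k) : e = e' := by
  apply htf
  intro p hp
  by_cases hpK : p ∈ K
  · exact h p hpK
  have hcp := hcov p hp hpK
  have h' : Twin K e' e := fun t ht => (h t ht).symm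
  have he2 : ∃ k ∈ K, e' ∈ k := by
    obtain ⟨k, hk, hek⟩ := he
    exact ⟨k, hk, (h k hk).1 hek⟩
  have he2' : ∃ k ∈ K, e' ∉ k := by
    obtain ⟨k, hk, hek⟩ := he'
    exact ⟨k, hk, fun h2 => hek ((h k hk).2 h2)⟩
  exact ⟨not_mem_of_twin_of_cover h he he' hcp, not_mem_of_twin_of_cover h' he2 he2' hcp⟩

/-- The covering hypothesis in the partition form of the local dichotomy
(`P₀ ∪ P₁ = P \ K`, `P₁ \\ K ⊆ K \\ K`, `K \\ P₀ ⊆ K \\ K`). -/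
theorem cover_of_partition {P K P₀ P₁ : Finset (Finset α)} (hU : P₀ ∪ P₁ = P \ K)
    (h1 : P₁ \\ K ⊆ K \\ K) (h0 : K \\ P₀ ⊆ K \\ K) :
    ∀ p ∈ P, p ∉ K → (∀ k ∈ K, p \ k ∈ K \\ K) ∨ (∀ k ∈ K, k \ p ∈ K \\ K) := by
  intro p hp hpK
  have : p ∈ P₀ ∪ P₁ := by
    rw [hU]
    exact mem_sdiff.2 ⟨hp, hpK⟩
  rcases mem_union.1 this with h | h
  · exact Or.inr (fun k hk => h0 (mem_diffs.2 ⟨k, hk, p, h, rfl⟩))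
  · exact Or.inl (fun k hk => h1 (mem_diffs.2 ⟨p, h, k, hk, rfl⟩))

/-- **The partner family of the open shape is twin-free on its difference support**: under the
hypotheses of `LocalDichotomyGenuine α` (only twin-freeness of `P` and the partition with its
two inclusions are used). -/
theorem eq_of_twin_of_partition {P K P₀ P₁ : Finset (Finset α)}
    (htf : ∀ a b, Twin P a b → a = b) (hU : P₀ ∪ P₁ = P \ K)
    (h1 : P₁ \\ K ⊆ K \\ K) (h0 : K \\ P₀ ⊆ K \\ K) {e e' : α} (h : Twin K e e')
    (he : ∃ k ∈ K, e ∈ k) (he' : ∃ k ∈ K, e ∉ k) : e = e' :=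
  eq_of_twin_of_cover htf (cover_of_partition hU h1 h0) h he he'

end PercRepro.MSTight
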